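import Literature.Topology.FourManifolds.TrisectionsTwoFunctionAtlas
import Literature.Topology.FourManifolds.TrisectionsTopHeightBot
import Literature.Topology.FourManifolds.TrisectionsSectorMorse
import HarnessLib

/-!
# The handle decomposition of the first sector of the Morse-theoretic trisection

Topic `Literature/Topology/FourManifolds`; step F (part ii, first sector) of a Morse-theoretic
construction of Gay–Kirby's trisection for the fact seat
`provefact-Literature.Topology.FourManifolds.exists_isBalancedGKTrisection` (Gay–Kirby 2016,
Thm. 4 via §4, Lemma 14).  Everything in this file is **proved**; the one definition is the
explicit outer function of the corner form.

For the first sector `X₁ = {s ≤ 0, 2s ≤ T}` of two-function sector data `D` over a bi-collar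
`B` (`TrisectionsTwoFunctionAtlas.lean`) whose top height is the top height `T_bot` of a system
of `2`-handle boxes (`TrisectionsTopHeightBot.lean`), the function
`ψ₁ = 1 - C U₁(-s) V₁(T/2 - s)` (`HandleBoxes.psiOneBot`) is fed into
`CornerSliceAtlas.hasHandleDecomposition_of_comp_val` (`TrisectionsSectorMorse.lean`) over the
corner-slice atlas `D.atlas₁`: it is smooth; in the corner charts along `F` it is the corner
form `1 - (C/2)·(2uv)`; it is `1` exactly on the faces and `< 1` inside; it is regular on the
faces off `F` and has no critical point on the band part of the sector
(`HandleBoxes.not_isMCriticalPt_psiOneBot`); below the band it carries the Morse data of `f`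
(`HandleBoxes.morseData_psiOneBot_below`).  Result (`hasHandleDecomposition_S₁`):
**`HasHandleDecomposition 3 ↥X₁ c` with `c i` the number of critical points of `f` of index `i`
below the level `a`** — for a self-indexing `f` with one minimum and `k` critical points of
index `1` this is `handleCount 1 k` ("`X₁ ≅ ♮ᵏ S¹ × B³`").

## References

* D. Gay, R. Kirby, *Trisecting 4-manifolds*, Geom. Topol. 20 (2016), §4, Lemma 14. [GayKirby2016]
* J. Milnor, *Morse theory* (1963), Thm. 3.1 and §3. [Milnor1963]
-/

open scoped Manifold ContDiff Topology
open Set Function Filter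

noncomputable section

universe u

namespace Literature.Topology.FourManifolds

open Flow

/-- Local notation: `𝔼 n` is the model Euclidean space `EuclideanSpace ℝ (Fin n)`. -/
local notation "𝔼 " n:arg => EuclideanSpace ℝ (Fin n)

/-- **The outer function of the corner form**: `G(y) = 1 - (C/2) y₀`, so that
`G ∘ cornerFold = 1 - C · uv`. [folklore] -/
def cornerOuter (C : ℝ) (y : 𝔼 4) : ℝ := 1 - (C / 2) * y 0

/-- `G` is smooth. [folklore] -/
theorem contDiff_cornerOuter (C : ℝ) : ContDiff ℝ ∞ (cornerOuter C) :=
  contDiff_const.sub (contDiff_const.mul (EuclideanSpace.proj (0 : Fin 4) : 𝔼 4 →L[ℝ] ℝ).contDiff)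

/-- `dG ≠ 0` for `C ≠ 0`. [folklore] -/
theorem fderiv_cornerOuter_ne_zero {C : ℝ} (hC : C ≠ 0) (y : 𝔼 4) : fderiv ℝ (cornerOuter C) y ≠ 0 := by
  have h : HasFDerivAt (cornerOuter C) (-((C / 2) • (EuclideanSpace.proj (0 : Fin 4) : 𝔼 4 →L[ℝ] ℝ))) y := by
    have := ((EuclideanSpace.proj (0 : Fin 4) : 𝔼 4 →L[ℝ] ℝ).hasFDerivAt (x := y)).const_mul (C / 2)
    exact this.const_sub 1
  rw [h.fderiv]
  intro h0
  have h1 := congrArg (fun L : 𝔼 4 →L[ℝ] ℝ => L (EuclideanSpace.single (0 : Fin 4) (1 : ℝ))) h0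
  simp at h1
  exact hC h1

/-- `G (cornerFold y) = 1 - C y₀ y₁`. [folklore] -/
theorem cornerOuter_cornerFold (C : ℝ) (y : 𝔼 4) : cornerOuter C (cornerFold y) = 1 - C * (y 0 * y 1) := by
  rw [cornerOuter, cornerFold_apply_zero]; ring

variable {X : Type u} [TopologicalSpace X] [T2Space X] [CompactSpace X] [ChartedSpace (𝔼 4) X]
  [IsManifold (𝓡 4) ∞ X]
  (B : BiCollar X) {η : ℝ} {ι : Type} [Fintype ι] {ζ : Π x : X, TangentSpace (𝓡 4) x}
  (H : HandleBoxes B.f ζ B.a η ι) {hζ : ContMDiff (𝓡 4) (𝓡 4).tangent ∞ fun x => (⟨x, ζ x⟩ : TangentBundle (𝓡 4) X)}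
  {h₂ TP χlo χhi U₁ V₁ : ℝ → ℝ} {Spl Sbot Smin Psw C : ℝ} (D : B.TwoFnData)

namespace BiCollar.TwoFnData

/-- **The handle decomposition of the first sector.**  Hypotheses: the top height of `D` is
`T_bot`; the hypotheses of the band and below-band analyses of `ψ₁`
(`TrisectionsTopHeightBot.lean`); the profiles are the identity near `0` (corner form) with
`U₁ = 1` far out, positive with the stated derivative signs; `-S_min ≤ T` with `S_min < 2η`.
Conclusion: `HasHandleDecomposition 3 ↥X₁ c`, `c i = #{crit f of index i below a}`.
[cite: GayKirby2016, §4, Lemma 14] [cite: Milnor1963, Thm. 3.1 and §3] -/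
theorem hasHandleDecomposition_S₁ (hgl : IsGradientLike (𝓡 4) B.f ζ) (hfM : IsMorse (𝓡 4) B.f)
    (hDT : D.T = H.topHeightBot hζ B.hf B.g h₂ TP χlo χhi Spl Sbot Smin Psw)
    (hT : ContMDiff (𝓡 4) 𝓘(ℝ, ℝ) ∞ (H.topHeight hζ B.hf B.g h₂ TP χlo χhi Spl Smin Psw))
    (hχlo : ContDiff ℝ ∞ χlo) (hχhi : ContDiff ℝ ∞ χhi)
    {P₁ v₁ : ℝ} (hPsw0 : 0 < Psw) (hPsw : 2 * Psw ≤ η ^ 2) (hP₁ : 2 * P₁ < Psw)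
    (hTP₂ : ∀ P, 2 * P₁ ≤ P → TP P = Spl) (hh₂v : ∀ t ≤ v₁, h₂ t = Spl)
    (hφv : ∀ j (y : RegularLevel B.hf), y.1 ∈ (H.box j).chart.source → H.P j y.1 < 2 * Psw → B.g y ≤ v₁)
    (hU : ContDiff ℝ ∞ U₁) (hV : ContDiff ℝ ∞ V₁) (hC : 0 < C)
    (hD : ∀ z, B.a - η < B.f z → B.f z ≤ B.a →
      H.topCoeffBot hζ B.hf B.g h₂ TP χlo χhi Spl Sbot Smin Psw z ≤ 0)
    (hU_id : ∀ u ∈ Ico 0 D.εw, U₁ u = u) (hV_id : ∀ v ∈ Ico 0 ((1 + D.lam / 2) * D.εw), V₁ v = v)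
    (hUpos : ∀ u, 0 < u → 0 < U₁ u) (hVpos : ∀ v, 0 < v → 0 < V₁ v)
    (hV' : ∀ v, 0 ≤ v → 0 ≤ deriv V₁ v)
    (hface : ∀ u v, 0 ≤ u → 0 ≤ v → (0 < u ∨ 0 < v) → 0 < deriv U₁ u * V₁ v + U₁ u * deriv V₁ v)
    {σ₀ : ℝ} (hσ₀ : 0 < σ₀)
    (hbelow_cut : ∀ s, s < -η + σ₀ → χlo s = 0 ∧ χhi s = 1)
    (hbelow_U : ∀ u, η - σ₀ < u → U₁ u = 1)
    (hbelow_V' : ∀ v, 0 < deriv V₁ v)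
    (hTge : ∀ z, -Smin ≤ D.T z) (hSmin : Smin < 2 * η) :
    letI := D.atlas₁.chartedSpace
    HasHandleDecomposition 3 D.S₁ fun i => (criticalSetOfIndex (𝓡 4) B.f i ∩ B.f ⁻¹' Iio B.a).ncard := by
  letI := D.atlas₁.chartedSpace
  have hη := H.eta_pos
  set ψ := H.psiOneBot hζ B.hf B.g h₂ TP χlo χhi Spl Sbot Smin Psw U₁ V₁ C with hψ
  have hTbc : ContMDiff (𝓡 4) 𝓘(ℝ, ℝ) ∞ (H.topHeightBot hζ B.hf B.g h₂ TP χlo χhi Spl Sbot Smin Psw) :=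
    H.contMDiff_topHeightBot hfM hχlo hT
  have hcontf : Continuous B.f := hfM.contMDiff.continuous
  -- values of `ψ`
  have hψ_apply : ∀ z, ψ z = 1 - C * (U₁ (B.a - B.f z) * V₁ (D.T z / 2 - (B.f z - B.a))) := by
    intro z; simp only [hψ, HandleBoxes.psiOneBot, hDT]
  -- smoothness
  have hψc : ContMDiff (𝓡 4) 𝓘(ℝ, ℝ) ∞ ψ := by
    have hs : ContMDiff (𝓡 4) 𝓘(ℝ, ℝ) ∞ fun z => B.f z - B.a := hfM.contMDiff.sub contMDiff_const
    have hs' : ContMDiff (𝓡 4) 𝓘(ℝ, ℝ) ∞ fun z => B.a - B.f z := contMDiff_const.sub hfM.contMDiff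
    have : ψ = fun z => 1 - C * (U₁ (B.a - B.f z) *
        V₁ (H.topHeightBot hζ B.hf B.g h₂ TP χlo χhi Spl Sbot Smin Psw z / 2 - (B.f z - B.a))) := by
      funext z; simp only [hψ, HandleBoxes.psiOneBot]
    rw [this]
    exact contMDiff_const.sub (contMDiff_const.mul ((hU.contMDiff.comp hs').mul
      (hV.contMDiff.comp ((hTbc.div_const 2).sub hs))))
  -- the no-critical-point lemma in usable form
  have hnocrit : ∀ z, B.a - η < B.f z → B.f z ≤ B.a → 0 ≤ D.T z / 2 - (B.f z - B.a) →
      (0 < B.a - B.f z ∨ 0 < D.T z / 2 - (B.f z - B.a)) → ¬ IsMCriticalPt (𝓡 4) ψ z := by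
    intro z hf₁ hf₂ hv huv
    have hu : 0 ≤ B.a - B.f z := by linarith
    have hDT' : D.T z = H.topHeightBot hζ B.hf B.g h₂ TP χlo χhi Spl Sbot Smin Psw z := by rw [hDT]
    refine H.not_isMCriticalPt_psiOneBot hgl hfM hT hχlo hχhi hPsw0 hPsw hP₁ hTP₂ hh₂v hφv hU hV hC.ne' hf₁ hf₂
      (hD z hf₁ hf₂) ?_ ?_ ?_
    · rcases hu.eq_or_lt with h0 | h0
      · rw [← h0, hU_id 0 ⟨le_rfl, D.εw_pos⟩]
      · exact (hUpos _ h0).le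
    · rw [← hDT']; exact hV' _ hv
    · rw [← hDT']; exact hface _ _ hu hv huv
  -- below the band
  have hbelow : ∀ z, B.f z ≤ B.a - η →
      (IsMCriticalPt (𝓡 4) ψ z ↔ IsMCriticalPt (𝓡 4) B.f z) ∧
        (IsMCriticalPt (𝓡 4) B.f z → (mhessian (𝓡 4) ψ z).Nondegenerate ∧ morseIndex (𝓡 4) ψ z = morseIndex (𝓡 4) B.f z) := by
    intro z hz
    refine H.morseData_psiOneBot_below hfM hV hC ?_ ?_ (hbelow_V' _)
    · have : Iio (-η + σ₀) ∈ 𝓝 (B.f z - B.a) := Iio_mem_nhds (by linarith)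
      exact Filter.mem_of_superset this fun s hs => hbelow_cut s hs
    · have : Ioi (η - σ₀) ∈ 𝓝 (B.a - B.f z) := Ioi_mem_nhds (by linarith)
      exact Filter.mem_of_superset this fun u hu => hbelow_U u hu
  -- critical points of `f` below `a` are below the band
  have hcritf : ∀ z, IsMCriticalPt (𝓡 4) B.f z → B.f z < B.a → B.f z < B.a - η := by
    intro z hc hlt
    by_contra hge; push Not at hge
    obtain ⟨j, rfl⟩ := H.crit_val z hc hge (by linarith)
    have := H.apply_cpt j; linarith
  refine D.atlas₁.hasHandleDecomposition_of_comp_val (F := ψ) (fun q _ _ => hψc q)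
    (fun p hp => ?_) (fun p hb => ?_) (fun p hb hpK => ?_) (fun p hi => ?_) (fun p hi hc => ?_) (fun i => ?_)
  · -- corner form
    refine ⟨cornerOuter C, (contDiff_cornerOuter C).contDiffAt, fderiv_cornerOuter_ne_zero hC.ne' _, fun q hq hqS => ?_⟩
    have hqb : q ∈ B.box D.εw := hq.1
    rw [cornerOuter_cornerFold, (D.atlas₁.cornerDatum p hp).apply_zero q hq, (D.atlas₁.cornerDatum p hp).apply_one q hq,
      uFun_W₁, vFun_W₁, hψ_apply, D.T_box q hqb]
    obtain ⟨hs, hr⟩ := (mem_box_iff).1 hqb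
    have hu : 0 ≤ -B.sFun q := by have := ((D.mem_S₁_iff_of_mem_box q hqb).1 hqS).1; rw [uFun_W₁] at this; exact this
    have hv : 0 ≤ -B.sFun q - D.lam / 2 * B.rFun q := by
      have := ((D.mem_S₁_iff_of_mem_box q hqb).1 hqS).2; rw [vFun_W₁] at this; exact this
    have hlam := D.lam_pos
    have hU1 : U₁ (B.a - B.f q) = -B.sFun q := by
      rw [show B.a - B.f q = -B.sFun q by rw [BiCollar.sFun]; ring]
      exact hU_id _ ⟨hu, by have := (abs_lt.1 hs); linarith [this.1]⟩
    have hV1 : V₁ (-D.lam * B.rFun q / 2 - (B.f q - B.a)) = -B.sFun q - D.lam / 2 * B.rFun q := by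
      rw [show -D.lam * B.rFun q / 2 - (B.f q - B.a) = -B.sFun q - D.lam / 2 * B.rFun q by rw [BiCollar.sFun]; ring]
      refine hV_id _ ⟨hv, ?_⟩
      have h1 := abs_lt.1 hs; have h2 := abs_lt.1 hr
      nlinarith
    rw [hU1, hV1]
  · -- `= 1` on the boundary
    rcases (D.isBoundaryPoint₁_iff p).1 hb with h0 | h0
    · rw [hψ_apply, show B.a - B.f p.1 = 0 by linarith, hU_id 0 ⟨le_rfl, D.εw_pos⟩]; ring
    · rw [hψ_apply, show D.T p.1 / 2 - (B.f p.1 - B.a) = 0 by linarith, hV_id 0 ⟨le_rfl, by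
        have := D.lam_pos; have := D.εw_pos; positivity⟩]; ring
  · -- regular on the boundary off `F`
    have hp := p.2
    rcases (D.isBoundaryPoint₁_iff p).1 hb with h0 | h0
    · -- face `s = 0`, `T > 0`
      have hT0 : 0 < D.T p.1 := by
        rcases (show 0 ≤ D.T p.1 by have := hp.2; linarith).eq_or_lt with h | h
        · exact absurd (D.surface_of p.1 (by linarith) h.symm) hpK
        · exact h
      exact hnocrit p.1 (by linarith) (by linarith) (by linarith) (Or.inr (by linarith))
    · -- face `T = 2s`, `s < 0`
      have hs0 : B.f p.1 - B.a < 0 := by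
        rcases hp.1.eq_or_lt with h | h
        · exact absurd (D.surface_of p.1 (by linarith) (by linarith)) hpK
        · exact h
      have hband : B.a - η < B.f p.1 := by have := hTge p.1; linarith
      exact hnocrit p.1 hband (by linarith) (by linarith) (Or.inl (by linarith))
  · -- `< 1` inside
    obtain ⟨h1, h2⟩ := (D.isInteriorPoint₁_iff p).1 hi
    rw [hψ_apply]
    have := mul_pos (hUpos _ (by linarith : 0 < B.a - B.f p.1)) (hVpos _ (by linarith : 0 < D.T p.1 / 2 - (B.f p.1 - B.a)))
    nlinarith
  · -- nondegenerate at interior critical points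
    obtain ⟨h1, h2⟩ := (D.isInteriorPoint₁_iff p).1 hi
    by_cases hband : B.a - η < B.f p.1
    · exact absurd hc (hnocrit p.1 hband (by linarith) (by linarith) (Or.inl (by linarith)))
    · push Not at hband
      obtain ⟨hiff, hdata⟩ := hbelow p.1 (by linarith)
      exact (hdata (hiff.1 hc)).1
  · -- counts
    congr 1
    ext x
    simp only [mem_inter_iff, mem_image, mem_criticalSetOfIndex, mem_preimage, mem_Iio]
    constructor
    · rintro ⟨⟨p, hpi, rfl⟩, hc, hidx⟩
      obtain ⟨h1, h2⟩ := (D.isInteriorPoint₁_iff p).1 hpi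
      have hband : ¬ (B.a - η < B.f p.1) := fun hb => hnocrit p.1 hb (by linarith) (by linarith) (Or.inl (by linarith)) hc
      push Not at hband
      obtain ⟨hiff, hdata⟩ := hbelow p.1 (by linarith)
      have hcf := hiff.1 hc
      exact ⟨⟨hcf, by rw [← (hdata hcf).2]; exact hidx⟩, by linarith⟩
    · rintro ⟨⟨hcf, hidx⟩, hlt⟩
      have hlt' := hcritf x hcf hlt
      have hxS : x ∈ D.S₁ := ⟨by linarith, by have := hTge x; linarith⟩
      have hint : (𝓡∂ 4).IsInteriorPoint (⟨x, hxS⟩ : D.S₁) :=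
        (D.isInteriorPoint₁_iff ⟨x, hxS⟩).2 ⟨by show B.f x - B.a < 0; linarith, by
          show 2 * (B.f x - B.a) < D.T x; have := hTge x; linarith⟩
      obtain ⟨hiff, hdata⟩ := hbelow x (by linarith)
      refine ⟨⟨⟨x, hxS⟩, hint, rfl⟩, hiff.2 hcf, ?_⟩
      rw [(hdata hcf).2]; exact hidx

end BiCollar.TwoFnData

end Literature.Topology.FourManifolds

end
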